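import Summits.QuantumFields.YangMills.Theorems.UnitScaleTiltProp7PinnedCovBiharmonicSolve
import Summits.QuantumFields.YangMills.Theorems.UnitScaleTiltProp7CovHodgeSplit
import Summits.QuantumFields.YangMills.Theorems.UnitScaleTiltProp7LinearCorrectorMap
import Summits.QuantumFields.YangMills.Theorems.UnitScaleTiltProp7ExactCorrectorGaugeSockets
import HarnessLib

/-!
# Route `UnitScaleTilt`, crux K1 «MinimiserStabilityRegPr» (stmt-QuantumFields-19200), route-R E′ path (α′), (E1-e)∕(E1-b): THE LINEAR CORRECTOR `LinCorr` AS AN ADDITIVE MAP ON THE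
# TORUS OF RECORD — ✓ `Prop7LinearCorrectorMap.exists_linearCorrector_of_interp` INSTANTIATED at the covariant letters of the (E1) row (`Δ_𝒰 = divB ∘ covD`, `D*_𝒰 = divB`,
# pins `C = ι_k(T^{(k)})`), with every hypothesis DISCHARGED by landed files: interpolants exist (✓ `Prop7PinnedCovBiharmonicSolve.exists_covInterpolant`), are unique
# (✓ `Prop7PinnedCovBiharmonicUniqueness.eq_zero_of_pinned_covBilaplace_off`), potentials exist (✓ `Prop7CovHodgeSplit.exists_covHodgeSplit`)

Cell `ym3-torus`, width seat `ym3-torus-px13` (gen 3); ★routeR-w3 g6 NAMER WORD (5) 2026-08-28T21:54Z «px13 g3: LINCORR-T3 GO»; filed under ★p1 g15's standing PASS for (E1-a…e).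
THEOREMS ONLY (0 `def`, 0 `sorry`, 0 `instance`); `--supports stmt-QuantumFields-19200`, count-neutral.  YM₃ on T³ is a ladder rung (R3), not the Clay problem; nothing here
claims the stub, the crux, d = 4 or the gap.

WHAT IS PROVED (ns `…Theorems.Prop7LinearCorrectorT3`).
§1 ANY TORUS `Site P j`, ANY UNITARY BACKGROUND `U : Fin d → Site P j → (M_N(ℂ))ˣ`, ANY nonempty homogeneous finset of pins `C`:
* `covLaplace_fun_add`, `covBilaplace_sub_apply`, `covBilaplace_zero_of_covLaplace_zero` — linearity bookkeeping of `Δ_U`, `Δ_U²` (over ✓ `covLaplace_add'`∕`covBilaplace_add`).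
* `isInterp_unique`, `isInterp_add`, `isInterp_self_of_harmonic` — the interpolation relation «`χ = φ` on `C`, `Δ_U²χ = 0` off `C`» is uniquely solvable, additive, reflexive on
  `Δ_U`-harmonic fields.
* `exists_potential` — `∀ A, ∃ φ, ∀ x, Δ_Uφ(x) = D*_UA(x)` (from the covariant Hodge split).
* ★★★ `exists_linCorr` — `∃ (I : (Site → M_N) →+ (Site → M_N)) (L : (Fin d → Site → M_N) →+ (Site → M_N))` with (a) `I φ` IS the pinned `Δ_U`-biharmonic interpolant of `φ|_C`
  (agrees on `C`, `Δ_U²(Iφ) = 0` off `C`, and every such `χ` equals `I φ`); (b) `L A = φ − I φ` for EVERY potential `φ` of `A`; (c) `L A` vanishes on `C`; (d) for every `A` the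
  relational data `(φ, φ_H := I φ)` of ✓ `Prop7CentreHarmonicRegaugeSupCov` exist with `L A = φ − φ_H`.
§2 THE T³ READING (run `K` of a T³ family, ANY `SU(2)` background `W`, any `k`; `𝒰 := fun κ z => unitsField (toUField W) ⟨z, κ⟩`, pins `range (embIter k)`):
* ★★★ `exists_linCorr_T3` — the same four conclusions in the letters of ✓p666280's (E1) row ∕ ✓p671456's door (`hLC : ∀ A (y : Site k), L A (embIter k y) = 0`).
HONEST SCOPE.  Assembly of landed files; the only mathematics is «two potentials differ by a `Δ_U`-harmonic field, which is its own interpolant» (✓p670222).  `L` is the letter the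
(E1-d′) door ✓p667460 iterates and the (E1-b) door ✓p671456 bounds; its ANALYTIC rows (hK), (hK₂:=ρ₃) remain displayed there.

References: T. Bałaban, CMP 99 (1985) 75–102 [Balaban1985RegularSpaces] ((1.14) p.78); CMP 102 (1985) 277–309 [Balaban1985Variational] (Prop. 7 p.299);
CMP 99 (1985) 389–434 [Balaban1985BackgroundPropagators] ((3.8) p.392).
-/

set_option autoImplicit false

noncomputable section

open scoped BigOperators Matrix.Norms.L2Operator Matrix

namespace Summit.QuantumFields.YangMills.Theorems.Prop7LinearCorrectorT3

open Literature.MathematicalPhysics.QuantumFieldTheory.Balaban1983to89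
open B9Eq39Adjoint (R covD covDstar divB)
open B9TorusCalculus (torusT)
open Summit.QuantumFields.YangMills.Theorems.Prop7PinnedCovBiharmonicSolve (covLaplace_add' covBilaplace_add exists_covInterpolant)
open Summit.QuantumFields.YangMills.Theorems.Prop7PinnedCovBiharmonicUniqueness (eq_zero_of_pinned_covBilaplace_off)
open Summit.QuantumFields.YangMills.Theorems.Prop7CovHodgeSplit (exists_covHodgeSplit unitsField_toUField_mem_unitary)
open Summit.QuantumFields.YangMills.Theorems.Prop7LinearCorrectorMap (exists_linearCorrector_of_interp linearCorrector_vanishes_on)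
open Summit.QuantumFields.YangMills.Theorems.Prop7ExactCorrectorGaugeSockets (divB_sub)

variable {P : Params} {j : ℕ} {N : ℕ}

/-! ## §1 Generic torus, unitary background, homogeneous pins -/

section Generic

variable (U : Fin P.d → Site P j → (Matrix (Fin N) (Fin N) ℂ)ˣ)

/-- `Δ_U` is additive as a map into site fields. [cite: Balaban1985BackgroundPropagators, (3.8) p.392] -/
theorem covLaplace_fun_add (f g : Site P j → Matrix (Fin N) (Fin N) ℂ) :
    (fun x => divB (torusT P j) U (fun μ => covD (torusT P j) U μ (f + g)) x)
      = (fun x => divB (torusT P j) U (fun μ => covD (torusT P j) U μ f) x) + (fun x => divB (torusT P j) U (fun μ => covD (torusT P j) U μ g) x) := by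
  funext x
  exact covLaplace_add' U f g x

/-- `Δ_U²(f − g) = Δ_U²f − Δ_U²g` pointwise. [cite: Balaban1985BackgroundPropagators, (3.8) p.392] -/
theorem covBilaplace_sub_apply (f g : Site P j → Matrix (Fin N) (Fin N) ℂ) (x : Site P j) :
    divB (torusT P j) U (fun μ => covD (torusT P j) U μ (fun y => divB (torusT P j) U (fun ν => covD (torusT P j) U ν (f - g)) y)) x
      = divB (torusT P j) U (fun μ => covD (torusT P j) U μ (fun y => divB (torusT P j) U (fun ν => covD (torusT P j) U ν f) y)) x
        - divB (torusT P j) U (fun μ => covD (torusT P j) U μ (fun y => divB (torusT P j) U (fun ν => covD (torusT P j) U ν g) y)) x := by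
  have h := covBilaplace_add U (f - g) g x
  rw [sub_add_cancel] at h
  rw [h, add_sub_cancel_right]

/-- If `Δ_Uh = 0` (as a site field) then `Δ_U²h = 0` everywhere. [cite: Balaban1985BackgroundPropagators, (3.8) p.392] -/
theorem covBilaplace_zero_of_covLaplace_zero (h : Site P j → Matrix (Fin N) (Fin N) ℂ)
    (hh : (fun x => divB (torusT P j) U (fun μ => covD (torusT P j) U μ h) x) = 0) (x : Site P j) :
    divB (torusT P j) U (fun μ => covD (torusT P j) U μ (fun y => divB (torusT P j) U (fun ν => covD (torusT P j) U ν h) y)) x = 0 := by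
  rw [hh]
  simp only [divB, covDstar, covD, Pi.zero_apply, B9Eq39Adjoint.R_zero, sub_self, Finset.sum_const_zero]

variable {U}

/-- Uniqueness of the pinned `Δ_U`-biharmonic interpolant of given centre data (unitary background, homogeneous pins).
[cite: Balaban1985RegularSpaces, (1.14) p.78] -/
theorem isInterp_unique [NeZero N] (hU : ∀ ν x, (U ν x : Matrix (Fin N) (Fin N) ℂ) ∈ unitary (Matrix (Fin N) (Fin N) ℂ))
    (C : Finset (Site P j)) (hC : C.Nonempty)
    (htrans : ∀ c ∈ C, ∀ c' ∈ C, ∃ a : Site P j, (∀ x : Site P j, x ∈ C ↔ x + a ∈ C) ∧ c + a = c')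
    (φ χ χ' : Site P j → Matrix (Fin N) (Fin N) ℂ)
    (hχ : (∀ y ∈ C, χ y = φ y) ∧ ∀ z ∉ C, divB (torusT P j) U (fun μ => covD (torusT P j) U μ
        (fun y => divB (torusT P j) U (fun ν => covD (torusT P j) U ν χ) y)) z = 0)
    (hχ' : (∀ y ∈ C, χ' y = φ y) ∧ ∀ z ∉ C, divB (torusT P j) U (fun μ => covD (torusT P j) U μ
        (fun y => divB (torusT P j) U (fun ν => covD (torusT P j) U ν χ') y)) z = 0) :
    χ = χ' := by
  have hdiff : χ - χ' = 0 := by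
    refine eq_zero_of_pinned_covBilaplace_off hU C hC htrans (χ - χ') (fun y hy => ?_) (fun z hz => ?_)
    · rw [Pi.sub_apply, hχ.1 y hy, hχ'.1 y hy, sub_self]
    · rw [covBilaplace_sub_apply U χ χ' z, hχ.2 z hz, hχ'.2 z hz, sub_self]
  exact sub_eq_zero.mp hdiff

/-- The interpolation relation is additive. [cite: Balaban1985RegularSpaces, (1.14) p.78] -/
theorem isInterp_add (C : Finset (Site P j)) (φ φ' χ χ' : Site P j → Matrix (Fin N) (Fin N) ℂ)
    (hχ : (∀ y ∈ C, χ y = φ y) ∧ ∀ z ∉ C, divB (torusT P j) U (fun μ => covD (torusT P j) U μ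
        (fun y => divB (torusT P j) U (fun ν => covD (torusT P j) U ν χ) y)) z = 0)
    (hχ' : (∀ y ∈ C, χ' y = φ' y) ∧ ∀ z ∉ C, divB (torusT P j) U (fun μ => covD (torusT P j) U μ
        (fun y => divB (torusT P j) U (fun ν => covD (torusT P j) U ν χ') y)) z = 0) :
    (∀ y ∈ C, (χ + χ') y = (φ + φ') y) ∧ ∀ z ∉ C, divB (torusT P j) U (fun μ => covD (torusT P j) U μ
        (fun y => divB (torusT P j) U (fun ν => covD (torusT P j) U ν (χ + χ')) y)) z = 0 := by
  refine ⟨fun y hy => by rw [Pi.add_apply, Pi.add_apply, hχ.1 y hy, hχ'.1 y hy], fun z hz => ?_⟩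
  rw [covBilaplace_add U χ χ' z, hχ.2 z hz, hχ'.2 z hz, add_zero]

/-- A `Δ_U`-harmonic field is its own pinned interpolant. [cite: Balaban1985RegularSpaces, (1.14) p.78] -/
theorem isInterp_self_of_harmonic (C : Finset (Site P j)) (h : Site P j → Matrix (Fin N) (Fin N) ℂ)
    (hh : (fun x => divB (torusT P j) U (fun μ => covD (torusT P j) U μ h) x) = 0) :
    (∀ y ∈ C, h y = h y) ∧ ∀ z ∉ C, divB (torusT P j) U (fun μ => covD (torusT P j) U μ
        (fun y => divB (torusT P j) U (fun ν => covD (torusT P j) U ν h) y)) z = 0 :=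
  ⟨fun _ _ => rfl, fun z _ => covBilaplace_zero_of_covLaplace_zero U h hh z⟩

/-- Every bond field has a covariant longitudinal potential: `∀ A, ∃ φ, Δ_Uφ = D*_UA` (from ✓ `exists_covHodgeSplit`). [cite: Balaban1985BackgroundPropagators, (3.8) p.392] -/
theorem exists_potential (hU : ∀ ν x, (U ν x : Matrix (Fin N) (Fin N) ℂ) ∈ unitary (Matrix (Fin N) (Fin N) ℂ))
    (A : Fin P.d → Site P j → Matrix (Fin N) (Fin N) ℂ) :
    ∃ φ : Site P j → Matrix (Fin N) (Fin N) ℂ, ∀ x, divB (torusT P j) U (fun μ => covD (torusT P j) U μ φ) x = divB (torusT P j) U A x := by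
  obtain ⟨φ, hdiv, -⟩ := exists_covHodgeSplit U hU A
  refine ⟨φ, fun x => ?_⟩
  have h := hdiv x
  have e : (fun μ y => A μ y - covD (torusT P j) U μ φ y) = A - (fun μ => covD (torusT P j) U μ φ) := by
    funext μ y; rfl
  rw [e, divB_sub] at h
  exact (sub_eq_zero.mp h).symm

/-- ★★★ **THE LINEAR CORRECTOR AS AN ADDITIVE MAP, GENERIC TORUS.**  Unitary background `U`, nonempty homogeneous finset of pins `C`.  There are additive maps `I` (pinned
`Δ_U`-biharmonic interpolation of centre data) and `L` (the corrector `LinCorr`) such that: (a) `I φ = φ` on `C`, `Δ_U²(Iφ) = 0` off `C`, and every field with these two properties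
equals `I φ`; (b) `L A = φ − I φ` for EVERY potential `φ` of `A` (`Δ_Uφ = D*_UA`); (c) `L A` vanishes on `C`; (d) for every `A` there IS a potential `φ` with `L A = φ − I φ`.
[cite: Balaban1985Variational, Prop. 7 p.299; Balaban1985RegularSpaces, (1.14) p.78; Balaban1985BackgroundPropagators, (3.8) p.392] -/
theorem exists_linCorr [NeZero N] (hU : ∀ ν x, (U ν x : Matrix (Fin N) (Fin N) ℂ) ∈ unitary (Matrix (Fin N) (Fin N) ℂ))
    (C : Finset (Site P j)) (hC : C.Nonempty)
    (htrans : ∀ c ∈ C, ∀ c' ∈ C, ∃ a : Site P j, (∀ x : Site P j, x ∈ C ↔ x + a ∈ C) ∧ c + a = c') :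
    ∃ (I : (Site P j → Matrix (Fin N) (Fin N) ℂ) →+ (Site P j → Matrix (Fin N) (Fin N) ℂ))
      (L : (Fin P.d → Site P j → Matrix (Fin N) (Fin N) ℂ) →+ (Site P j → Matrix (Fin N) (Fin N) ℂ)),
      (∀ φ, ((∀ y ∈ C, I φ y = φ y) ∧ ∀ z ∉ C, divB (torusT P j) U (fun μ => covD (torusT P j) U μ
          (fun y => divB (torusT P j) U (fun ν => covD (torusT P j) U ν (I φ)) y)) z = 0) ∧
        ∀ χ, ((∀ y ∈ C, χ y = φ y) ∧ ∀ z ∉ C, divB (torusT P j) U (fun μ => covD (torusT P j) U μ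
          (fun y => divB (torusT P j) U (fun ν => covD (torusT P j) U ν χ) y)) z = 0) → χ = I φ) ∧
      (∀ A φ, (∀ x, divB (torusT P j) U (fun μ => covD (torusT P j) U μ φ) x = divB (torusT P j) U A x) → L A = φ - I φ) ∧
      (∀ A, ∀ y ∈ C, L A y = 0) ∧
      (∀ A, ∃ φ, (∀ x, divB (torusT P j) U (fun μ => covD (torusT P j) U μ φ) x = divB (torusT P j) U A x) ∧ L A = φ - I φ) := by
  -- the two additive operators
  let Lap : (Site P j → Matrix (Fin N) (Fin N) ℂ) →+ (Site P j → Matrix (Fin N) (Fin N) ℂ) :=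
    AddMonoidHom.mk' (fun φ => fun x => divB (torusT P j) U (fun μ => covD (torusT P j) U μ φ) x) (covLaplace_fun_add U)
  let Dstar : (Fin P.d → Site P j → Matrix (Fin N) (Fin N) ℂ) →+ (Site P j → Matrix (Fin N) (Fin N) ℂ) :=
    AddMonoidHom.mk' (fun A => fun x => divB (torusT P j) U A x) (fun A B => funext fun x => by
      have h := divB_sub (torusT P j) U (A + B) B x
      rw [add_sub_cancel_right] at h
      rw [Pi.add_apply, h, sub_add_cancel])
  -- the interpolation relation
  let IsInterp : (Site P j → Matrix (Fin N) (Fin N) ℂ) → (Site P j → Matrix (Fin N) (Fin N) ℂ) → Prop := fun φ χ =>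
    (∀ y ∈ C, χ y = φ y) ∧ ∀ z ∉ C, divB (torusT P j) U (fun μ => covD (torusT P j) U μ
      (fun y => divB (torusT P j) U (fun ν => covD (torusT P j) U ν χ) y)) z = 0
  have hex : ∀ φ, ∃ χ, IsInterp φ χ := fun φ => exists_covInterpolant hU C hC htrans φ
  have huniq : ∀ φ χ χ', IsInterp φ χ → IsInterp φ χ' → χ = χ' := fun φ χ χ' h h' => isInterp_unique hU C hC htrans φ χ χ' h h'
  have hadd : ∀ φ φ' χ χ', IsInterp φ χ → IsInterp φ' χ' → IsInterp (φ + φ') (χ + χ') := fun φ φ' χ χ' h h' => isInterp_add C φ φ' χ χ' h h'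
  have hharm : ∀ h, Lap h = 0 → IsInterp h h := fun h hh => isInterp_self_of_harmonic C h hh
  have hsolv : ∀ A, ∃ φ, Lap φ = Dstar A := fun A => by
    obtain ⟨φ, hφ⟩ := exists_potential hU A
    exact ⟨φ, funext hφ⟩
  obtain ⟨I, L, hI, hL⟩ := exists_linearCorrector_of_interp Lap Dstar IsInterp hex huniq hadd hharm hsolv
  have hLfun : ∀ A φ, (∀ x, divB (torusT P j) U (fun μ => covD (torusT P j) U μ φ) x = divB (torusT P j) U A x) → L A = φ - I φ :=
    fun A φ hφ => hL A φ (funext hφ)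
  have hIC : ∀ φ, ∀ c ∈ (C : Set (Site P j)), I φ c = φ c := fun φ c hc => (hI φ).1.1 c hc
  have hLC : ∀ A, ∀ y ∈ (C : Set (Site P j)), L A y = 0 :=
    fun A => linearCorrector_vanishes_on (C : Set (Site P j)) Lap Dstar I L hIC hsolv hL A
  refine ⟨I, L, hI, hLfun, fun A y hy => hLC A y hy, fun A => ?_⟩
  obtain ⟨φ, hφ⟩ := exists_potential hU A
  exact ⟨φ, hφ, hLfun A φ hφ⟩

end Generic

/-! ## §2 The T³ reading -/

section T3

open Literature.MathematicalPhysics.QuantumFieldTheory.Balaban1983to89.T3ContinuumYM3Torus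
open B10Eq27TorusAxialLog (unitsField toUField)
open B15DeterminingSets (embIter)
open Summit.QuantumFields.YangMills.Theorems.Prop7PinnedHarmonicMass (centres_homogeneous)

/-- ★★★ **`LinCorr` ON THE T³ CARRIER** (run `K` of a T³ family, ANY `SU(2)` background `W`, any `k`; `𝒰 := fun κ z => unitsField (toUField W) ⟨z, κ⟩`, pins `ι_k(T^{(k)})`):
additive maps `I`, `L` on matrix site ∕ bond fields with (a) `I φ` = the pinned `Δ_W`-biharmonic interpolant of `φ` on the `k`-centres (characterised); (b) `L A = φ − I φ` for every
potential `Δ_Wφ = D*_WA`; (c) `L A (ι_k y) = 0` (the door's `hLC`); (d) potentials exist.  The letter `L` of ✓ `exists_unique_exact_corrector_gauge` and of ✓ `linCorr_gauge_le_of_rows`.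
[cite: Balaban1985Variational, Prop. 7 p.299; Balaban1985RegularSpaces, (1.14) p.78; Balaban1985BackgroundPropagators, (3.8) p.392] -/
theorem exists_linCorr_T3 (F : T3Family) (K k : ℕ) (W : GaugeField (F.P K) 0 (Matrix.specialUnitaryGroup (Fin 2) ℂ)) :
    ∃ (I : (Site (F.P K) 0 → Matrix (Fin 2) (Fin 2) ℂ) →+ (Site (F.P K) 0 → Matrix (Fin 2) (Fin 2) ℂ))
      (L : (Fin (F.P K).d → Site (F.P K) 0 → Matrix (Fin 2) (Fin 2) ℂ) →+ (Site (F.P K) 0 → Matrix (Fin 2) (Fin 2) ℂ)),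
      (∀ φ, ((∀ y : Site (F.P K) k, I φ (embIter k y) = φ (embIter k y)) ∧
          ∀ x : Site (F.P K) 0, x ∉ Set.range (embIter k) →
            divB (torusT (F.P K) 0) (fun κ z => unitsField (toUField W) ⟨z, κ⟩)
              (fun μ => covD (torusT (F.P K) 0) (fun κ z => unitsField (toUField W) ⟨z, κ⟩) μ
                (fun y => divB (torusT (F.P K) 0) (fun κ z => unitsField (toUField W) ⟨z, κ⟩)
                  (fun ν => covD (torusT (F.P K) 0) (fun κ z => unitsField (toUField W) ⟨z, κ⟩) ν (I φ)) y)) x = 0) ∧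
        ∀ χ, (∀ y : Site (F.P K) k, χ (embIter k y) = φ (embIter k y)) →
          (∀ x : Site (F.P K) 0, x ∉ Set.range (embIter k) →
            divB (torusT (F.P K) 0) (fun κ z => unitsField (toUField W) ⟨z, κ⟩)
              (fun μ => covD (torusT (F.P K) 0) (fun κ z => unitsField (toUField W) ⟨z, κ⟩) μ
                (fun y => divB (torusT (F.P K) 0) (fun κ z => unitsField (toUField W) ⟨z, κ⟩)
                  (fun ν => covD (torusT (F.P K) 0) (fun κ z => unitsField (toUField W) ⟨z, κ⟩) ν χ) y)) x = 0) → χ = I φ) ∧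
      (∀ A φ, (∀ x, divB (torusT (F.P K) 0) (fun κ z => unitsField (toUField W) ⟨z, κ⟩)
            (fun μ => covD (torusT (F.P K) 0) (fun κ z => unitsField (toUField W) ⟨z, κ⟩) μ φ) x
          = divB (torusT (F.P K) 0) (fun κ z => unitsField (toUField W) ⟨z, κ⟩) A x) → L A = φ - I φ) ∧
      (∀ (A) (y : Site (F.P K) k), L A (embIter k y) = 0) ∧
      (∀ A, ∃ φ, (∀ x, divB (torusT (F.P K) 0) (fun κ z => unitsField (toUField W) ⟨z, κ⟩)
            (fun μ => covD (torusT (F.P K) 0) (fun κ z => unitsField (toUField W) ⟨z, κ⟩) μ φ) x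
          = divB (torusT (F.P K) 0) (fun κ z => unitsField (toUField W) ⟨z, κ⟩) A x) ∧ L A = φ - I φ) := by
  classical
  set C : Finset (Site (F.P K) 0) := (Finset.univ : Finset (Site (F.P K) k)).image (embIter k) with hCdef
  have hCne : C.Nonempty := ⟨embIter k default, Finset.mem_image_of_mem _ (Finset.mem_univ _)⟩
  have hU := fun κ (z : Site (F.P K) 0) => unitsField_toUField_mem_unitary W κ z
  have hmemC : ∀ x : Site (F.P K) 0, x ∈ C ↔ x ∈ Set.range (embIter k) := by
    intro x
    rw [hCdef, Finset.mem_image, Set.mem_range]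
    exact ⟨fun ⟨y, _, hy⟩ => ⟨y, hy⟩, fun ⟨y, hy⟩ => ⟨y, Finset.mem_univ _, hy⟩⟩
  have hembC : ∀ y : Site (F.P K) k, embIter k y ∈ C := fun y => (hmemC _).2 ⟨y, rfl⟩
  obtain ⟨I, L, hI, hL, hLC, hLex⟩ :=
    exists_linCorr (U := fun κ z => unitsField (toUField W) ⟨z, κ⟩) hU C hCne (centres_homogeneous k)
  refine ⟨I, L, fun φ => ⟨⟨fun y => (hI φ).1.1 _ (hembC y), fun x hx => (hI φ).1.2 x fun hxC => hx ((hmemC x).1 hxC)⟩, fun χ h0 hbi => ?_⟩,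
    hL, fun A y => hLC A _ (hembC y), hLex⟩
  refine (hI φ).2 χ ⟨fun y hy => ?_, fun z hz => hbi z fun hzr => hz ((hmemC z).2 hzr)⟩
  obtain ⟨y', hy'⟩ := (hmemC y).1 hy
  rw [← hy']
  exact h0 y'

end T3

end Summit.QuantumFields.YangMills.Theorems.Prop7LinearCorrectorT3

end
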